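import Summits.BirchSwinnertonDyer.BirchSwinnertonDyer.Theses.UniversalToricDescent
import Summits.BirchSwinnertonDyer.BirchSwinnertonDyer.Theorems.UniversalToricDescentTwinChoiceByName
import HarnessLib

/-!
# Route UniversalToricDescent — closer of the re-keyed route KERNEL 23596 `ToricKernelAtThreeApZero`

Prover bsd-wall-utd-p1 g8 (`--workitem stmt-BirchSwinnertonDyer-23596`; the route file's own recipe). The R2′
kernel: published inputs → transport (crux #2, 20186) → printed bucket-A facts → bucket A of print → bucket B
→ the `a₃ = 0` good-supersingular crux (23594) → the `a₃ = 0` twin supply (23595) → Waldspurger → control →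
rank-zero twist → `BSD₃(E)` for every `E` of the attacked cell (ClassO6 at `3`, `r_an = 1`, `ρ̄₃` onto, a
semistable-at-`3` onto twin) — by utd-p2's twin-choice kernel BY NAME
`UniversalToricDescentTwinChoice.bsdp_three_of_apZero_of_cellSupply` (p579882; twin-choice kernel p576995):
the binders of the spelled-out crux 23594 are re-packed into `TwinIMCAtThreeAt W′`, the supply is definitionally
`HasGoodSSTwinAtThree W → HasGoodSSApZeroTwinAtThree W`. An IMPLICATION between route items; nothing
upstream (20186, 23594, 20694, …) is claimed. THEOREM ONLY; BSD is not advanced by this file.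
References: [JetchevSkinnerWan2017] (shape of the BSD₃ read-off, context only).
-/

set_option autoImplicit false
-- `…BirchSwinnertonDyer.BirchSwinnertonDyer.Theorems…` is the problem's mandated namespace (D-0017).
set_option linter.dupNamespace false

namespace Summit.BirchSwinnertonDyer.BirchSwinnertonDyer.Theorems

/-- **Item 23596 holds** (the R2′ route kernel), by `bsdp_three_of_apZero_of_cellSupply`. [folklore] -/
theorem toricKernelAtThreeApZero_proof :
    Summit.BirchSwinnertonDyer.BirchSwinnertonDyer.Theses.UniversalToricDescent.ToricKernelAtThreeApZero := by
  intro hF hT hP hA hB hS0 hsupply hV hC hZ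
  exact UniversalToricDescentTwinChoice.bsdp_three_of_apZero_of_cellSupply hF hT hP hA hB
    (fun W' _ _ hss ha hsurj N' _ K _ _ Dt' hN hK hH hodd κ hκ γ _ 𝔭 h𝔭 he hf 𝔭' h𝔭' hne ι' hι ↦
      hS0 W' N' K Dt' hss ha hsurj hN hK hH hodd κ hκ γ 𝔭 h𝔭 he hf 𝔭' h𝔭' hne ι' hι)
    (fun W _ _ hO6 hr hsurj htwin ↦ hsupply W hO6 hr hsurj htwin) hV hC hZ

end Summit.BirchSwinnertonDyer.BirchSwinnertonDyer.Theorems
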